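import Mathlib.AlgebraicGeometry.Modules.Sheaf
import HarnessLib

/-!
# Units of `f^* ⊣ f_*` under composition and under equal morphisms

Bookkeeping for the inverse-image pseudofunctor of modules on schemes (Mathlib
`Scheme.Modules.pullbackComp`, `pullbackCongr`, `pushforwardComp`; EGA 0_I (4.4.3), "transitivity
of inverse images"): how the UNIT `M → f_* f^* M` of `f^* ⊣ f_*` behaves

* under composition — `unit_comp_map_pullbackComp_inv`: the unit of `(f ≫ g)^* ⊣ (f ≫ g)_*`,
  followed by `(f ≫ g)_*` of `pullbackComp⁻¹ : (f ≫ g)^* M → f^* g^* M`, is the unit of `g` followed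
  by `g_*` of the unit of `f` at `g^*M` and the identification `g_* f_* = (f ≫ g)_*` (the transpose
  of Mathlib's `Scheme.Modules.conjugateEquiv_pullbackComp_inv`, via `unit_conjugateEquiv`);
* under equal morphisms — `unit_comp_map_pullbackCongr_hom_comp`: for `h : f = f'`, the unit of
  `f` followed by `f_*` of (`pullbackCongr h` then a morphism `θ` out of `f'^*M`) is the unit of
  `f'` followed by `f'_*θ`, up to the `eqToHom` identifying `f_*` with `f'_*`.

These are the two inputs needed to compute adjuncts of morphisms out of iterated inverse images
(e.g. the structure isomorphisms `(t_n)^* ι_{n+1}^* ℱ ≅ ι_n^* ℱ` of formal completions,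
`Literature.AlgebraicGeometry.FormalGeometry.TowerModule.completionIso`) on sections. Everything is
proved; no definitions, no named facts.

## References

* A. Grothendieck, J. Dieudonné, *EGA I* (Springer 1971), 0, (4.4.3)–(4.4.8). [folklore]
-/

noncomputable section

-- `TopCat.Presheaf`/`Scheme.Modules` are not reducible (as in Mathlib's `AlgebraicGeometry/Modules/Sheaf.lean`).
set_option backward.isDefEq.respectTransparency false

open CategoryTheory AlgebraicGeometry

universe u

namespace Literature.AlgebraicGeometry.Modules

variable {X Y Z : Scheme.{u}} (f : X ⟶ Y) (g : Y ⟶ Z)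

/-- **The unit of `(f ≫ g)^* ⊣ (f ≫ g)_*` versus the units of `f^* ⊣ f_*` and `g^* ⊣ g_*`** under the
pseudofunctoriality isomorphisms `pullbackComp`/`pushforwardComp` (transpose of Mathlib's
`Scheme.Modules.conjugateEquiv_pullbackComp_inv`). [folklore] -/
theorem unit_comp_map_pullbackComp_inv (M : Z.Modules) :
    (Scheme.Modules.pullbackPushforwardAdjunction (f ≫ g)).unit.app M ≫
        (Scheme.Modules.pushforward (f ≫ g)).map ((Scheme.Modules.pullbackComp f g).inv.app M) =
      (Scheme.Modules.pullbackPushforwardAdjunction g).unit.app M ≫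
        (Scheme.Modules.pushforward g).map
          ((Scheme.Modules.pullbackPushforwardAdjunction f).unit.app
            ((Scheme.Modules.pullback g).obj M)) ≫
        (Scheme.Modules.pushforwardComp f g).hom.app _ := by
  have h := unit_conjugateEquiv
    ((Scheme.Modules.pullbackPushforwardAdjunction g).comp
      (Scheme.Modules.pullbackPushforwardAdjunction f))
    (Scheme.Modules.pullbackPushforwardAdjunction (f ≫ g)) (Scheme.Modules.pullbackComp f g).inv M
  rw [Scheme.Modules.conjugateEquiv_pullbackComp_inv, Adjunction.comp_unit_app] at h
  simp only [Category.assoc] at h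
  exact h.symm

/-- **Units along equal morphisms**: for `h : f = f'`, the unit of `f^* ⊣ f_*` followed by
`f_*` of a morphism out of `f'^*M` precomposed with `pullbackCongr h` is the unit of `f'^* ⊣ f'_*`
followed by `f'_*` of that morphism (up to the `eqToHom` identifying `f_*` and `f'_*`). [folklore] -/
theorem unit_comp_map_pullbackCongr_hom_comp {f f' : X ⟶ Y} (h : f = f') (M : Y.Modules)
    {N : X.Modules} (θ : (Scheme.Modules.pullback f').obj M ⟶ N) :
    (Scheme.Modules.pullbackPushforwardAdjunction f).unit.app M ≫
        (Scheme.Modules.pushforward f).map ((Scheme.Modules.pullbackCongr h).hom.app M ≫ θ) =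
      (Scheme.Modules.pullbackPushforwardAdjunction f').unit.app M ≫
        (Scheme.Modules.pushforward f').map θ ≫ eqToHom (by rw [h]) := by
  subst h
  simp [Scheme.Modules.pullbackCongr]

end Literature.AlgebraicGeometry.Modules
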